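import Mathlib
import Summits.ValiantsHypothesis.ValiantsHypothesis.Theorems.NewtonTauWeak.Negative.Zonogon
import Summits.ValiantsHypothesis.ValiantsHypothesis.Theorems.NewtonUnitEquationsNewtonTauWeakLevelSetOfT2
import Summits.ValiantsHypothesis.ValiantsHypothesis.Theorems.NewtonUnitEquationsNewtonTauWeakRefineDissociate

/-!
# `NewtonUnitEquationsNewtonTauWeakLevelSetOfT2All` — the binomial T2 bound controls EVERY weighted level set

Line `binomial-normal-form` of crux `NewtonTauWeak` (stmt-ValiantsHypothesis-5904), lead c6, wave 2: composition of
the landed stubs `stub_refineDissociate` (dissociation is free for hull counts: a scale refinement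
`d' j = M • d j + single 0 2^j` never decreases the number of hull vertices of a weighted level set) and
`stub_levelSetOfT2` (a level-ISOLATING graded design, Vandermonde scalars over `K = Σ g + 1` nodes, has support EXACTLY
the level set on a dissociated list, so the stub's inequality with exponent `b` bounds its vertices by
`((Σ g + 1)N + 2)^b`).

`levelSet_of_T2`: IF the open registered stub `stub_binomialNewtonTauCommon` (KPTT Conj. 1 at `t = 2`, polynomial form)
holds with exponent `b`, THEN for all `N`, all weights `g : Fin N → ℕ`, all exponent lists `d` (coincidences allowed) and
all levels `v`, the weighted level set `X_v = {Σ_{j∈J} d j : Σ_{j∈J} g j = v}` has at most `((Σ_j g j + 1)·N + 2)^b` hull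
vertices.  This is the formal KILL SWITCH of the line's one-cell dichotomy: any family of weighted level sets with
super-polynomially many hull vertices (in `N` and `Σ g`) refutes the stub, hence `DissociatedUniform` at `t = 2` and KPTT's
Conjecture 1 in its printed polynomial form (NOT the weak crux, whose `2^{am}` slack absorbs every `t = 2` instance).

Folklore-level; no named facts, no citations, no `def`s.
-/

-- Sub = Summit single-conjunct layout: the duplicated namespace component is mandated by the tree.
set_option linter.dupNamespace false

noncomputable section

open scoped BigOperators
open MvPolynomial
open Summit.ValiantsHypothesis.ValiantsHypothesis.Theorems.NewtonTauWeak.Negative (vert)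

namespace Summit.ValiantsHypothesis.ValiantsHypothesis.Theorems.NewtonUnitEquationsNewtonTauWeak

/-- **T2 ⇒ polynomial hull counts for ALL weighted level sets.**  If sums of `K` scalar multiples of products of `N`
binomials over a common exponent list have `≤ (KN+2)^b` Newton vertices (the open stub with exponent `b`), then every
weighted level set `{Σ_J d : Σ_J g = v}` — any weights, any exponents — has `≤ ((Σ_j g j + 1)N + 2)^b` hull vertices:
refine `d` to a dissociated list without losing vertices (`stub_refineDissociate`) and apply the level-isolating design
(`stub_levelSetOfT2`). [folklore] -/
theorem levelSet_of_T2 (b : ℕ)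
    (hT2 : ∀ (K N : ℕ) (c : Fin K → ℂ) (ρ : Fin K → Fin N → ℂ) (d : Fin N → (Fin 2 →₀ ℕ)),
      vert (∑ l, C (c l) * ∏ j, (1 - C (ρ l j) * monomial (d j) 1)) ≤ (K * N + 2) ^ b)
    (N v : ℕ) (g : Fin N → ℕ) (d : Fin N → (Fin 2 →₀ ℕ)) :
    (Set.extremePoints ℝ (convexHull ℝ ((fun e : Fin 2 →₀ ℕ => fun i : Fin 2 => ((e i : ℕ) : ℝ)) ''
      (((Finset.univ.filter fun J : Finset (Fin N) => ∑ j ∈ J, g j = v).image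
        fun J => ∑ j ∈ J, d j : Finset (Fin 2 →₀ ℕ)) : Set (Fin 2 →₀ ℕ))))).ncard ≤
      ((∑ j, g j + 1) * N + 2) ^ b := by
  obtain ⟨d', hdis, hle⟩ := stub_refineDissociate N v g d
  exact hle.trans (stub_levelSetOfT2 b hT2 N v g d' hdis)

end Summit.ValiantsHypothesis.ValiantsHypothesis.Theorems.NewtonUnitEquationsNewtonTauWeak

end
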